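import Mathlib
import HarnessLib
import Literature.Geometry.Lorentzian.KerrConvergence
import Literature.Geometry.Lorentzian.ConvergenceTransport
import Literature.Geometry.Lorentzian.TimeCones

/-!
# Route StarvedNecks — crux `FutureOrientedOfSeamed` (stmt-FinalStateConjecture-17576), line `Sketch`:
# stub `stub_coneHandshake`

The one-point "cone handshake" at an anchor point `z` of a chart `Ψ : B.domain → 𝓢` on a model
background `B`: if the metric deviation `(Ψ^* g − g_B)(z)` has operator norm `≤ 1/(20 K)`, `dΨ A`
is future-directed with `g_B(A, A) ≤ −1/2` and `‖A‖² ≤ K`, and `W` is a coordinate vector with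
`g_B(A, W) = −1` (clock duality), `‖W‖² ≤ 13 K` and `dΨ W` causal, then `dΨ W` is future-directed.
Indeed `g(dΨ A, dΨ A) = g_B(A, A) + dev(A, A) ≤ −1/2 + K/(20 K) < 0`, so `dΨ A` is timelike, and
`g(dΨ A, dΨ W) = −1 + dev(A, W) ≤ −1 + 4K/(20 K) < 0` (`‖A‖ ‖W‖ ≤ 4 K` because
`‖A‖² ‖W‖² ≤ 13 K² ≤ 16 K²`), whence the timecone lemma
`TimeOrientation.isFutureDirected_of_val_lt_zero` (O'Neill 1983, Ch. 5, Lemma 5.29, p. 145)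
applies with `T' = dΨ A`, `v = dΨ W`.

References: B. O'Neill, *Semi-Riemannian geometry with applications to relativity*, Academic
Press 1983, Ch. 5, Lemma 5.26–5.29, p. 145.

[folklore]
-/

noncomputable section

set_option linter.dupNamespace false
-- instance search through nested operator types `E4 →L[ℝ] E4 →L[ℝ] ℝ`
set_option maxSynthPendingDepth 3

open Set Filter Topology Function
open scoped Manifold ContDiff ENNReal Topology
open Literature.Geometry.Lorentzian

namespace Summit.FinalStateConjecture.FinalStateConjecture.Theorems.FutureOrientedOfSeamed.ClockDualityRays

/-- **One entry of the metric deviation is bounded by the operator norm.** For a chart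
`Ψ : B.domain → 𝓢` on a model background `B` and coordinate vectors `v`, `w`,
`(Ψ^* g − g_B)(z)(v, w) ≤ ‖(Ψ^* g − g_B)(z)‖ ‖v‖ ‖w‖` (`Real.le_norm_self` and the bilinear
operator-norm bound `ContinuousLinearMap.le_opNorm₂`). DHRT arXiv:2104.08222, §1 (pointwise norms
of the metric deviation); O'Neill 1983, Ch. 5, Lemma 5.29, p. 145 (use). [folklore] -/
private theorem deviation_apply_le_norm_mul (𝓢 : Spacetime.{0} 4) (B : ModelBackground)
    (Ψ : B.domain → 𝓢.carrier) (z : B.domain) (v w : E4) :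
    𝓢.deviation B Ψ z v w ≤ ‖𝓢.deviation B Ψ z‖ * ‖v‖ * ‖w‖ :=
  (Real.le_norm_self _).trans ((𝓢.deviation B Ψ z).le_opNorm₂ v w)

/-- **One-point cone handshake.** At a point `z` of a model background `B` charted by
`Ψ : B.domain → 𝓢` with `‖(Ψ^* g − g_B)(z)‖ ≤ 1/(20 K)` (`K > 0`): if `dΨ A` is future-directed
with `g_B(A, A) ≤ −1/2` and `‖A‖² ≤ K`, and `W` is a coordinate vector with `g_B(A, W) = −1`
(clock duality), `‖W‖² ≤ 13 K` and `dΨ W` causal, then `dΨ W` is future-directed. Proof: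
`g(dΨ A, dΨ A) = g_B(A, A) + dev(A, A) ≤ −1/2 + K/(20 K) < 0` (`Spacetime.deviation_apply`,
operator-norm bound), so `dΨ A` is timelike; `‖A‖ ‖W‖ ≤ 4 K` (as `‖A‖² ‖W‖² ≤ 13 K² ≤ 16 K²`), so
`g(dΨ A, dΨ W) = −1 + dev(A, W) ≤ −1 + 4 K/(20 K) < 0`; conclude by the timecone lemma
`TimeOrientation.isFutureDirected_of_val_lt_zero` with `T' = dΨ A`, `v = dΨ W`. B. O'Neill,
*Semi-Riemannian geometry*, Academic Press 1983, Ch. 5, Lemma 5.29, p. 145. [folklore] -/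
theorem stub_coneHandshake (𝓢 : Spacetime.{0} 4) (B : ModelBackground) (Ψ : B.domain → 𝓢.carrier)
    (z : B.domain) (A W : E4) {K : ℝ} (hK : 0 < K)
    (hA : 𝓢.timeOrientation.IsFutureDirected (mfderiv 𝓘(ℝ, E4) (𝓡 4) Ψ z A))
    (hAA : B.bilin z.1 A A ≤ -(1 / 2)) (hAn : ‖A‖ ^ 2 ≤ K) (hAW : B.bilin z.1 A W = -1)
    (hW : ‖W‖ ^ 2 ≤ 13 * K) (hWc : 𝓢.metric.IsCausal (mfderiv 𝓘(ℝ, E4) (𝓡 4) Ψ z W))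
    (hdev : ‖𝓢.deviation B Ψ z‖ ≤ 1 / (20 * K)) :
    𝓢.timeOrientation.IsFutureDirected (mfderiv 𝓘(ℝ, E4) (𝓡 4) Ψ z W) := by
  -- adapted from `isTimelike_mfderiv_of_norm_deviation_le` / `isFutureDirected_mfderiv_of_pairing_neg`
  -- (Summits/FinalStateConjecture/FinalStateConjecture/Cruxes/FutureOrientedOfSeamed/LeverKitIdeator1)
  have hA0 : 0 ≤ ‖A‖ := norm_nonneg _
  have hW0 : 0 ≤ ‖W‖ := norm_nonneg _
  have hδ0 : 0 ≤ 1 / (20 * K) := by positivity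
  -- (a) `dΨ A` is timelike: `g(dΨ A, dΨ A) = g_B(A, A) + dev(A, A) ≤ -1/2 + 1/20 < 0`
  have happAA := 𝓢.deviation_apply B Ψ z A A
  have hleAA := deviation_apply_le_norm_mul 𝓢 B Ψ z A A
  have h1 : ‖𝓢.deviation B Ψ z‖ * ‖A‖ * ‖A‖ ≤ 1 / (20 * K) * K := by
    rw [mul_assoc, ← sq]
    exact mul_le_mul hdev hAn (sq_nonneg _) hδ0
  have h1' : 1 / (20 * K) * K = 1 / 20 := by
    field_simp
  have hAt : 𝓢.metric.IsTimelike (mfderiv 𝓘(ℝ, E4) (𝓡 4) Ψ z A) := by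
    show 𝓢.metric.val (Ψ z) (mfderiv 𝓘(ℝ, E4) (𝓡 4) Ψ z A) (mfderiv 𝓘(ℝ, E4) (𝓡 4) Ψ z A) < 0
    linarith
  -- (b) the pairing: `g(dΨ A, dΨ W) = -1 + dev(A, W) ≤ -1 + 4K/(20K) < 0`
  have happAW := 𝓢.deviation_apply B Ψ z A W
  have hleAW := deviation_apply_le_norm_mul 𝓢 B Ψ z A W
  have hP : ‖A‖ * ‖W‖ ≤ 4 * K := by
    have hsq : (‖A‖ * ‖W‖) ^ 2 ≤ (4 * K) ^ 2 := by
      rw [mul_pow]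
      calc ‖A‖ ^ 2 * ‖W‖ ^ 2 ≤ K * (13 * K) := mul_le_mul hAn hW (sq_nonneg _) hK.le
        _ ≤ (4 * K) ^ 2 := by nlinarith
    exact le_of_sq_le_sq hsq (by positivity)
  have h2 : ‖𝓢.deviation B Ψ z‖ * ‖A‖ * ‖W‖ ≤ 1 / (20 * K) * (4 * K) := by
    rw [mul_assoc]
    exact mul_le_mul hdev hP (mul_nonneg hA0 hW0) hδ0
  have h2' : 1 / (20 * K) * (4 * K) = 1 / 5 := by
    field_simp
    norm_num
  have hneg : 𝓢.metric.val (Ψ z) (mfderiv 𝓘(ℝ, E4) (𝓡 4) Ψ z A)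
      (mfderiv 𝓘(ℝ, E4) (𝓡 4) Ψ z W) < 0 := by
    linarith
  exact 𝓢.timeOrientation.isFutureDirected_of_val_lt_zero hA hAt hWc hneg

end Summit.FinalStateConjecture.FinalStateConjecture.Theorems.FutureOrientedOfSeamed.ClockDualityRays

end
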